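import Literature.AlgebraicGeometry.Frobenioids.PadicFrobenioidRelCosetBase
import HarnessLib

/-!
# Frobenioids II, Thm. 2.4 setting p. 19: NON-VACUITY of the structural inputs "`Ψ_Base = θ_*` 1-compatibly" — the identity
# functor over `θ = id`

Mochizuki, *The geometry of Frobenioids II*, Kyushu J. Math. **62** (2008) 401–460, §2, Theorem 2.4 p. 19
[cite: MochizukiFrdII2008, Thm 2.4 (i) p.19]: "an equivalence of categories `Ψ : C₁ ⥲ C₂` — which … necessarily induces a
1-compatible equivalence of categories `Ψ_Base : D₁ ⥲ D₂`, hence an outer isomorphism of topological groups `Π₁ ⥲ Π₂`".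

Kernel witness (seat abc-iut-L1-t7, gen 5) that the input shape of abc-iut-L1-t7's `hbase_of_pushCompat` /
`thm24i_ofFunctorRel_ofTheta` — an open homomorphism `θ : Π₁ → Π₂` with `hkerθ`, an isomorphism
`e : θ_*((A₁)_D) ≅ (Ψ A₁)_D` in `B^temp(Π₂)⁰` and `compat : Base((Ψα)⁻¹) = e⁻¹ ≫ θ_*(Base(α⁻¹)) ≫ e` — is INHABITED by the
tautological case `Ψ = 𝟭`, `θ = id`, for EVERY `p`-adic Frobenioid over EVERY base `B^temp(Π, Π°)⁰` and EVERY object: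
`pushIdIso` (`(id)_*(Π/V) ≅ Π/V`, the two objects differ only by `V.map id` vs `V`), `hkerθ_id`, `compat_id`. Pure plumbing over
abc-iut-L5-t2's `CosetCat.push`; nothing here concerns [IUTchIII].
-/

namespace Literature.AlgebraicGeometry.Frobenioids

namespace PadicFrd

namespace RelGal

open CategoryTheory Literature.AnabelianGeometry.SemiGraphs

variable {P : Type} [Group P] [TopologicalSpace P]

/-- `1·V` is fixed by `id(V)`. [cite: MochizukiFrdII2008, Ex 1.3 (ii) p.11] -/
theorem smul_one_eq_of_mem_pushId (X : CosetCat P) :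
    ∀ u ∈ ((CosetCat.push (MonoidHom.id P) IsOpenMap.id).obj X).sg, u • ((1 : P) : X.carrier) = ((1 : P) : X.carrier) := by
  intro u hu
  obtain ⟨v, hv, rfl⟩ := (CosetCat.mem_mapOpen (MonoidHom.id P) IsOpenMap.id).mp hu
  rw [MonoidHom.id_apply, CosetCat.smul_one_eq_one_iff]
  exact hv

/-- `1·id(V)` is fixed by `V`. [cite: MochizukiFrdII2008, Ex 1.3 (ii) p.11] -/
theorem smul_one_pushId_eq_of_mem (X : CosetCat P) :
    ∀ u ∈ X.sg, u • ((1 : P) : ((CosetCat.push (MonoidHom.id P) IsOpenMap.id).obj X).carrier) =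
      ((1 : P) : ((CosetCat.push (MonoidHom.id P) IsOpenMap.id).obj X).carrier) := by
  intro u hu
  rw [CosetCat.smul_one_eq_one_iff]
  exact (CosetCat.mem_mapOpen (MonoidHom.id P) IsOpenMap.id).mpr ⟨u, hu, rfl⟩

/-- **`(id)_*(Π/V) ≅ Π/V`** in `B^temp(Π)⁰` (`id(V) = V`; both points `1`). [cite: MochizukiFrdII2008, Ex 1.3 (ii) p.11] -/
noncomputable def pushIdIso (X : CosetCat P) : (CosetCat.push (MonoidHom.id P) IsOpenMap.id).obj X ≅ X where
  hom := CosetCat.homMk ((1 : P) : X.carrier) (smul_one_eq_of_mem_pushId X)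
  inv := CosetCat.homMk ((1 : P) : ((CosetCat.push (MonoidHom.id P) IsOpenMap.id).obj X).carrier)
    (smul_one_pushId_eq_of_mem X)
  hom_inv_id := CosetCat.hom_ext (by
    rw [CosetCat.pt_comp, CosetCat.pt_homMk, CosetCat.homMk_toFun_coe, one_smul, CosetCat.pt_id])
  inv_hom_id := CosetCat.hom_ext (by
    rw [CosetCat.pt_comp, CosetCat.pt_homMk, CosetCat.homMk_toFun_coe, one_smul, CosetCat.pt_id])

/-- The point of `pushIdIso.hom` is `1·V`. [cite: MochizukiFrdII2008, Ex 1.3 (ii) p.11] -/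
theorem pt_pushIdIso_hom (X : CosetCat P) : CosetCat.pt (pushIdIso X).hom = ((1 : P) : X.carrier) :=
  CosetCat.pt_homMk _ (smul_one_eq_of_mem_pushId X)

/-- The point of `pushIdIso.inv` is `1·id(V)`. [cite: MochizukiFrdII2008, Ex 1.3 (ii) p.11] -/
theorem pt_pushIdIso_inv (X : CosetCat P) : CosetCat.pt (pushIdIso X).inv =
    ((1 : P) : ((CosetCat.push (MonoidHom.id P) IsOpenMap.id).obj X).carrier) :=
  CosetCat.pt_homMk _ (smul_one_pushId_eq_of_mem X)

variable {p : ℕ} [Fact p.Prime] (φ₀ : P →* QuasiTemperoid.GalFbar ℚ_[p]) {P₀ : OpenSubgroup P}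
  (d : Datum (RelCosetCat P₀) p) (A : d.frobenioid)

omit [TopologicalSpace P] in
/-- `hkerθ` for `θ = id`. [cite: MochizukiFrdII2008, Thm 2.4 (i) p.19] -/
theorem hkerθ_id (x : P) : φ₀ x = 1 ↔ φ₀ (MonoidHom.id P x) = 1 := Iff.rfl

/-- **`compat` for `Ψ = 𝟭`, `θ = id`, `e = pushIdIso`**: `Base(α⁻¹) = e⁻¹ ≫ id_*(Base(α⁻¹)) ≫ e` — the structural input of
`thm24i_ofFunctorRel_ofTheta` is inhabited at the identity. [cite: MochizukiFrdII2008, Thm 2.4 (i) p.19] -/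
theorem compat_id (α : Aut A) :
    (ModelFrobenioid.baseMap ((𝟭 d.frobenioid).mapIso α).inv).hom =
      (pushIdIso A.base.obj).inv ≫ (CosetCat.push (MonoidHom.id P) IsOpenMap.id).map (ModelFrobenioid.baseMap α.inv).hom ≫
        (pushIdIso A.base.obj).hom := by
  show (ModelFrobenioid.baseMap α.inv).hom = _
  obtain ⟨π, hπ⟩ := QuotientGroup.mk_surjective (CosetCat.pt (ModelFrobenioid.baseMap α.inv).hom)
  apply CosetCat.hom_ext
  rw [CosetCat.pt_comp, pt_pushIdIso_inv, CosetCat.toFun_coe, one_smul, CosetCat.pt_comp, CosetCat.pt_push_map, ← hπ,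
    CosetCat.pushQuot_coe, CosetCat.toFun_coe, pt_pushIdIso_hom, MulAction.Quotient.smul_coe, smul_eq_mul,
    MonoidHom.id_apply, mul_one]

end RelGal

end PadicFrd

end Literature.AlgebraicGeometry.Frobenioids
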